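import Literature.NumberTheory.Automorphic.SmoothRepresentation
import Mathlib.Topology.LocallyConstant.Basic
import HarnessLib

/-!
# Smooth vectors have locally constant orbit maps

Topic `NumberTheory/Automorphic`; namespace `Representation` (continues `SmoothRepresentation`).  KERNEL file,
theorems only.

For a representation `ρ` of a topological group `G` (only separate continuity of multiplication is used) and a SMOOTH vector `v`
(`Representation.IsSmoothVector`: open stabiliser), the orbit map `g ↦ ρ(g)v` is LOCALLY CONSTANT; for a
smooth representation every orbit map is.  This is the form in which smoothness of the finite-adelic Weil
representation enters Weil's Lemme 5 / Théorème 6 (a locally constant family of Schwartz–Bruhat functions is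
locally dominated by one of its members): [Weil1964, Chap. III n° 39 p. 189] ("`Mp(X)_A` opère continûment"),
[BushnellHenniart2006, §2.1] (smooth = open stabilisers).

## References

* [Weil1964] A. Weil, Acta Math. 111 (1964), Chap. III n° 39, 41.
-/

open scoped Topology
open Filter

namespace Representation

variable {k G V : Type*} [CommRing k] [Group G] [AddCommGroup V] [Module k V]
variable (ρ : Representation k G V) [TopologicalSpace G]

/-- A vector fixed by a neighbourhood of `1` has a locally constant orbit map:
`ρ(g)v = ρ(g₀)v` for `g` near `g₀` (write `g = g₀ k`, `k` near `1`). [folklore] -/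
theorem eventually_apply_eq_of_mem_nhds_one [SeparatelyContinuousMul G] {v : V} {K : Set G} (hK : K ∈ 𝓝 (1 : G))
    (hfix : ∀ g ∈ K, ρ g v = v) (g₀ : G) : ∀ᶠ g in 𝓝 g₀, ρ g v = ρ g₀ v := by
  have hc : Continuous fun g : G => g₀⁻¹ * g := continuous_const_mul g₀⁻¹
  have hmem : (fun g : G => g₀⁻¹ * g) ⁻¹' K ∈ 𝓝 g₀ :=
    hc.continuousAt.preimage_mem_nhds (by simpa only [inv_mul_cancel] using hK)
  filter_upwards [hmem] with g hg
  rw [Set.mem_preimage] at hg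
  conv_lhs => rw [← mul_inv_cancel_left g₀ g, map_mul, Module.End.mul_apply, hfix _ hg]

/-- **A smooth vector has a locally constant orbit map.** [folklore] -/
theorem IsSmoothVector.isLocallyConstant_apply [SeparatelyContinuousMul G] {v : V} (hv : ρ.IsSmoothVector v) :
    IsLocallyConstant fun g : G => ρ g v := by
  refine (IsLocallyConstant.iff_eventually_eq _).2 fun g₀ => ?_
  exact ρ.eventually_apply_eq_of_mem_nhds_one
    (hv.mem_nhds (by simp only [SetLike.mem_coe, mem_stabilizerSubgroup, map_one, Module.End.one_apply]))
    (fun g hg => (ρ.mem_stabilizerSubgroup v g).1 hg) g₀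

/-- For `g` near `g₀`, `ρ(g)v = ρ(g₀)v` (smooth vector). [folklore] -/
theorem IsSmoothVector.eventually_apply_eq [SeparatelyContinuousMul G] {v : V} (hv : ρ.IsSmoothVector v) (g₀ : G) :
    ∀ᶠ g in 𝓝 g₀, ρ g v = ρ g₀ v :=
  ((IsLocallyConstant.iff_eventually_eq _).1 (hv.isLocallyConstant_apply ρ)) g₀

/-- **Every orbit map of a smooth representation is locally constant.** [folklore] -/
theorem IsSmooth.isLocallyConstant_apply [SeparatelyContinuousMul G] (hρ : ρ.IsSmooth) (v : V) :
    IsLocallyConstant fun g : G => ρ g v :=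
  (hρ v).isLocallyConstant_apply ρ

/-- … pointwise (as functions, when `V` is a space of functions `X → E`): each value `g ↦ (ρ(g)v)(x)` is
locally constant, hence continuous for any topology on `E`. [folklore] -/
theorem IsSmooth.isLocallyConstant_apply_apply [SeparatelyContinuousMul G] {X E : Type*} [AddCommGroup (X → E)]
    [Module k (X → E)] (π : Representation k G (X → E)) (hπ : π.IsSmooth) (v : X → E) (x : X) :
    IsLocallyConstant fun g : G => π g v x :=
  (hπ.isLocallyConstant_apply π v).comp (fun f : X → E => f x)

/-- Conversely, a vector with locally constant orbit map is smooth (its stabiliser is the preimage of a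
point under a locally constant map, hence open). [folklore] -/
theorem isSmoothVector_of_isLocallyConstant_apply {v : V} (h : IsLocallyConstant fun g : G => ρ g v) :
    ρ.IsSmoothVector v := by
  rw [isSmoothVector_iff]
  have : (ρ.stabilizerSubgroup v : Set G) = (fun g : G => ρ g v) ⁻¹' {v} := by
    ext g
    simp only [SetLike.mem_coe, mem_stabilizerSubgroup, Set.mem_preimage, Set.mem_singleton_iff]
  rw [this]
  exact h.isOpen_fiber v

/-- **Smooth ⇔ all orbit maps locally constant.** [folklore] -/
theorem isSmooth_iff_isLocallyConstant_apply [SeparatelyContinuousMul G] :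
    ρ.IsSmooth ↔ ∀ v : V, IsLocallyConstant fun g : G => ρ g v :=
  ⟨fun h v => h.isLocallyConstant_apply ρ v, fun h v => ρ.isSmoothVector_of_isLocallyConstant_apply (h v)⟩

end Representation
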